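import Literature.Computability.FineGrained.APSPToMinPlusProduct
import Literature.Computability.FineGrained.NegativeTriangleToAPSP
import HarnessLib

/-!
# Negative Triangle `≤₃` distance product (VW–W 2018, Thm. 4.1): the word-RAM program

Vassilevska Williams–Williams, J. ACM 65 (2018), Thm. 4.1 (p. 27:14): Negative Triangle over an
extended `(min,⊙)` structure reduces to matrix product *verification* by one product instance and
`n²` comparisons — "the problem becomes to determine whether there are `i, j, k ∈ [n]` so that
`A[i,k] ⊙ B[k,j] < C[i,j]`" with `A[i,k] = w(i,k)`, `B[k,j] = w(k,j)`, `C[i,j] = -w(i,j)`; for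
`⊙ = +` "the tripartiteness requirement is unnecessary" (§2, p. 27:7). Against the distance product
itself (the function problem `MinPlusProduct` of the zoo) the reduction is: one `(min,+)`-product
`W' ⋆ W'` of the weight matrix with `⊤` diagonal, then the `n²` tests `(W' ⋆ W') i j + W j i < 0`,
`i ≠ j` (`hasNegativeTriangle_iff_minPlus`, `Literature.Computability.Cryptography.GraphPathProblems`).

The prelude renders `≤₃` as `FGReducible` (VVW ICM 2018, Def. 2.1): the existence of a concrete
deterministic word-RAM oracle program. This file writes that program in the structured word-RAM
language `SProg` of `Literature.Computability.Cryptography.WordRAMStructured` and executes it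
symbolically phase by phase; the assembly into
`FGReducible (NegativeTriangle c) (n ↦ n³) (MinPlusProduct c) (n ↦ n³)` (the query is the encoding
of the instance `(W', W')`, decoding of the test words, time and ledger budgets) is
`Literature.Computability.FineGrained.NegativeTriangleToMinPlusProduct`.

## The program (`prog`) and its memory layout

The input is `x = encodeMatrixWithTop X` (`APSPPower.inp X`, here `X = W.map (↑)`): `|x| = n² + 1`,
`x₀ = n`, `x_{1+t} = code X t` (row-major codes, `t = i n + j`). The layout is that of
`Literature.Computability.FineGrained.APSPPowerDriver` (`dD`, `dQA`, `dQP`, `dQP2`):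

* `relocate` (`WordRAMStructured`): the input is moved to `D = n² + 101` (`n` at `D` and `D + 1`,
  `code X t` at `D + 2 + t`), freeing the cells `2 … 99` as registers;
* `block setupOps`: registers `r2 = n, r3 = n², r4 = D, r5 = QA, r6 = QB, r7 = AA, r8 = 2n² + 2`
  (query length), `r9 = QA + 1` (`Regs`), the two block headers `mem[QA] = mem[QB] = n`
  (`QA = dQA n`, `QB = dQP n`, `AA = dQP2 n`), and the registers of loop A;
* loop A, `whilenz r11 (block bodyA)`, `n²` iterations: iteration `t = i n + j` writes the code of
  `W' i j` — the input code multiplied by `[i ≠ j]` (`codeZ`), i.e. `⊤` on the diagonal — at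
  `QA + 1 + t` and at `QB + 1 + t`, so that the segment `[QA, QA + 2n² + 2)` becomes
  `encodeMatrixWithTop W' ++ encodeMatrixWithTop W'`, the encoding of the distance-product instance
  `(W', W')`;
* `query r5 r8 r7`: the oracle's answer `encodeMatrixWithTop (W' ⋆ W')` (reduced modulo `2 ^ w` by
  the machine) is written from `AA + 1` on, its length at `AA` (`segWrite`), so the code of
  `(W' ⋆ W') i j` sits at `AA + 2 + (i n + j)`;
* `block postOps` and loop C, `whilenz r11 (block bodyC)`, `n²` iterations: iteration `t = i n + j`
  reads the answer code `p` at `AA + 2 + t` and the query code `q = ⌜W' j i⌝` at `QA + 1 + (j n + i)`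
  and ors the test word `negTest p q` into a flag (`flagW`): `negTest p q = 1` iff `p ≠ 0`, `q ≠ 0`
  and `max p q` is even, which for codes of `a, b ∈ ℤ ∪ {∞}` says exactly `a + b < 0` (negative
  integers have the even nonzero codes, and of two codes of different parity the larger decides the
  sign of the sum) — here `(W' ⋆ W') i j + W' j i < 0`, the diagonal being excluded by `⌜⊤⌝ = 0`;
* `block finOps`: `mem[1] := flag; mem[0] := 1`, so the output is `[flag]`.

## Proof technique

As in `APSPPowerDriver`: registers below address `100` and data above (`merge S H`), straight-line
blocks by forward symbolic execution (`execOps_cons_fwd`, one `simp only` normaliser per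
operation), loops by `ExecLE.whilenz_invariant` with the invariants `InvA`, `InvC`.

## References

* V. Vassilevska Williams, R. R. Williams, *Subcubic equivalences between path, matrix, and triangle
  problems*, J. ACM 65 (2018), Art. 27: Thm. 4.1 (p. 27:14), §2 p. 27:7. doi:10.1145/3186893
* V. Vassilevska Williams, *On some fine-grained questions in algorithms and complexity*, Proc. ICM
  2018, §2, Def. 2.1 (fine-grained reductions on the word RAM).
* T. Nipkow, G. Klein, *Concrete Semantics with Isabelle/HOL*, Springer 2014, §7.2, §12.2.
-/

namespace Literature.Computability.FineGrained.NegTriToMinPlus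

open Cryptography Cryptography.WordRAM Cryptography.WordRAM.SProg Matrix APSPPower

/-! ## The program -/

/-- Setting up the layout registers `r2 = n, r3 = n², r4 = D, r5 = QA, r6 = QB, r7 = AA,
r8 = 2n² + 2, r9 = QA + 1`, the two block headers `mem[QA] = mem[QB] = n`, and the registers of
loop A (`r10` index, `r11` count, `r15` source, `r18, r19` destinations). [folklore] -/
def setupOps : List OpSpec :=
  [(.add, .dir 2, .ind 1, .imm 0), (.mul, .dir 3, .dir 2, .dir 2), (.add, .dir 4, .dir 1, .imm 0),
    (.add, .dir 5, .dir 4, .dir 3), (.add, .dir 5, .dir 5, .imm 2),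
    (.add, .dir 6, .dir 5, .dir 3), (.add, .dir 6, .dir 6, .imm 1),
    (.add, .dir 7, .dir 6, .dir 3), (.add, .dir 7, .dir 7, .imm 1),
    (.add, .dir 8, .dir 3, .dir 3), (.add, .dir 8, .dir 8, .imm 2),
    (.add, .dir 9, .dir 5, .imm 1),
    (.add, .ind 5, .dir 2, .imm 0), (.add, .ind 6, .dir 2, .imm 0),
    (.add, .dir 10, .imm 0, .imm 0), (.add, .dir 11, .dir 3, .imm 0),
    (.add, .dir 15, .dir 4, .imm 2), (.add, .dir 18, .dir 5, .imm 1), (.add, .dir 19, .dir 6, .imm 1)]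

/-- The body of loop A: entry `t = i n + j` (index `r10`, source pointer `r15`) of the input yields
the code of `W' i j` — the input code times `[i ≠ j]` — written at the two destination pointers
`r18`, `r19` (the two operand blocks of the query). [folklore] -/
def bodyA : List OpSpec :=
  [(.div, .dir 12, .dir 10, .dir 2), (.mod, .dir 13, .dir 10, .dir 2), (.eq, .dir 14, .dir 12, .dir 13),
    (.eq, .dir 14, .dir 14, .imm 0), (.add, .dir 16, .ind 15, .imm 0), (.mul, .dir 16, .dir 16, .dir 14),
    (.add, .ind 18, .dir 16, .imm 0), (.add, .ind 19, .dir 16, .imm 0),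
    (.add, .dir 15, .dir 15, .imm 1), (.add, .dir 18, .dir 18, .imm 1), (.add, .dir 19, .dir 19, .imm 1),
    (.add, .dir 10, .dir 10, .imm 1), (.sub, .dir 11, .dir 11, .imm 1)]

/-- After the query: the registers of loop C (`r10` index, `r11` count, `r17` flag, `r20` answer
pointer `AA + 2`). [folklore] -/
def postOps : List OpSpec :=
  [(.add, .dir 10, .imm 0, .imm 0), (.add, .dir 11, .dir 3, .imm 0), (.add, .dir 17, .imm 0, .imm 0),
    (.add, .dir 20, .dir 7, .imm 2)]

/-- The body of loop C: iteration `t = i n + j` reads the code `q` of `W' j i` at `QA + 1 + (j n + i)`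
and the answer code `p` at the answer pointer `r20`, computes the test word `negTest p q`
(`[max p q even] &&& [p ≠ 0] &&& [q ≠ 0]`, branch-free: `max p q = q [p < q] + p (1 - [p < q])`)
and ors it into the flag `r17`. [folklore] -/
def bodyC : List OpSpec :=
  [(.div, .dir 12, .dir 10, .dir 2), (.mod, .dir 13, .dir 10, .dir 2), (.mul, .dir 21, .dir 13, .dir 2),
    (.add, .dir 21, .dir 21, .dir 12), (.add, .dir 21, .dir 21, .dir 9),
    (.add, .dir 22, .ind 21, .imm 0), (.add, .dir 23, .ind 20, .imm 0),
    (.lt, .dir 24, .dir 23, .dir 22), (.mul, .dir 25, .dir 22, .dir 24), (.sub, .dir 26, .imm 1, .dir 24),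
    (.mul, .dir 26, .dir 23, .dir 26), (.add, .dir 25, .dir 25, .dir 26), (.band, .dir 25, .dir 25, .imm 1),
    (.eq, .dir 25, .dir 25, .imm 0),
    (.eq, .dir 26, .dir 23, .imm 0), (.eq, .dir 26, .dir 26, .imm 0),
    (.eq, .dir 27, .dir 22, .imm 0), (.eq, .dir 27, .dir 27, .imm 0),
    (.band, .dir 26, .dir 26, .dir 27), (.band, .dir 25, .dir 25, .dir 26),
    (.bor, .dir 17, .dir 17, .dir 25),
    (.add, .dir 20, .dir 20, .imm 1), (.add, .dir 10, .dir 10, .imm 1), (.sub, .dir 11, .dir 11, .imm 1)]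

/-- The output: `mem[1] := flag; mem[0] := 1` (the output list `[flag]`). [folklore] -/
def finOps : List OpSpec :=
  [(.add, .dir 1, .dir 17, .imm 0), (.add, .dir 0, .imm 1, .imm 0)]

/-- **The reduction program** Negative Triangle `≤₃` distance product (VW–W 2018, Thm. 4.1, against
the product itself): relocate the input, set up the layout, write the two copies of `⌜W'⌝` (loop A),
one oracle query on `⌜W'⌝ ++ ⌜W'⌝`, the `n²` sign tests (loop C), output the flag.
[cite: VassilevskaWilliamsWilliams2018, Thm. 4.1 (p. 27:14); §2 p. 27:7] -/
def prog : SProg :=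
  seqs [relocate, block setupOps, whilenz (.dir 11) (block bodyA),
    SProg.query (.dir 5) (.dir 8) (.dir 7), block postOps, whilenz (.dir 11) (block bodyC),
    block finOps]

/-- The compiled reduction program is deterministic. [folklore] -/
theorem prog_isDeterministic : prog.toProgram.IsDeterministic :=
  toProgram_isDeterministic _

/-! ## The words computed -/

/-- The code of entry `t = i n + j` of `W'` from the code `cd` of entry `t` of the input: `0 = ⌜⊤⌝` on
the diagonal `t / n = t mod n`, `cd` off it. [folklore] -/
def codeZ (n cd t : ℕ) : ℕ := if t / n = t % n then 0 else cd

/-- `codeZ` is bounded by the input code. [folklore] -/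
theorem codeZ_le (n cd t : ℕ) : codeZ n cd t ≤ cd := by
  unfold codeZ; split_ifs <;> omega

/-- The word `[p < q]`. [folklore] -/
def selW (p q : ℕ) : ℕ := if p < q then 1 else 0

/-- `[p < q] ≤ 1`. [folklore] -/
theorem selW_le_one (p q : ℕ) : selW p q ≤ 1 := by
  unfold selW; split_ifs <;> omega

/-- The branch-free maximum: `q [p < q] + p (1 - [p < q]) = max p q`. [folklore] -/
theorem maxW_eq (p q : ℕ) : q * selW p q + p * (1 - selW p q) = max p q := by
  unfold selW
  split_ifs with h
  · rw [max_eq_right h.le]; simp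
  · rw [max_eq_left (not_lt.1 h)]; simp

/-- **The test word of loop C** on an answer code `p` and a query code `q`:
`[max p q even] &&& ([p ≠ 0] &&& [q ≠ 0])`, literally as computed by `bodyC`. [folklore] -/
def negTest (p q : ℕ) : ℕ :=
  (if (q * selW p q + p * (1 - selW p q)) &&& 1 = 0 then 1 else 0) &&&
    ((if (if p = 0 then 1 else 0) = 0 then 1 else 0) &&& (if (if q = 0 then 1 else 0) = 0 then 1 else 0))

/-- The test word is `≤ 1`. [folklore] -/
theorem negTest_le_one (p q : ℕ) : negTest p q ≤ 1 :=
  le_trans Nat.and_le_left (NegTriToAPSP.ite_le_one _)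

/-- **Meaning of the test word**: `negTest p q = 1` iff `p ≠ 0`, `q ≠ 0` and `max p q` is even.
[folklore] -/
theorem negTest_eq_one_iff (p q : ℕ) : negTest p q = 1 ↔ p ≠ 0 ∧ q ≠ 0 ∧ max p q % 2 = 0 := by
  unfold negTest
  rw [maxW_eq, Nat.and_one_is_mod]
  by_cases hp : p = 0 <;> by_cases hq : q = 0 <;> by_cases hm : max p q % 2 = 0 <;>
    simp [hp, hq, hm]

/-- The flag of loop C after `t` iterations, from the answer codes `pv` and the query codes `qv`
read in iterations `0, …, t - 1`. [folklore] -/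
def flagW (pv qv : ℕ → ℕ) : ℕ → ℕ
  | 0 => 0
  | t + 1 => flagW pv qv t ||| negTest (pv t) (qv t)

/-- The flag is `≤ 1`. [folklore] -/
theorem flagW_le_one (pv qv : ℕ → ℕ) : ∀ t, flagW pv qv t ≤ 1
  | 0 => by simp [flagW]
  | t + 1 => NegTriToAPSP.or_le_one (flagW_le_one pv qv t) (negTest_le_one _ _)

/-- **Meaning of the flag**: it is `1` iff some test so far succeeded. [folklore] -/
theorem flagW_eq_one_iff (pv qv : ℕ → ℕ) :
    ∀ t, flagW pv qv t = 1 ↔ ∃ s, s < t ∧ negTest (pv s) (qv s) = 1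
  | 0 => by simp [flagW]
  | t + 1 => by
      rw [flagW, NegTriToAPSP.or_eq_one_iff (flagW_le_one pv qv t) (negTest_le_one _ _),
        flagW_eq_one_iff pv qv t]
      constructor
      · rintro (⟨s, hs, h⟩ | h)
        · exact ⟨s, Nat.lt_succ_of_lt hs, h⟩
        · exact ⟨t, Nat.lt_succ_self t, h⟩
      · rintro ⟨s, hs, h⟩
        rcases Nat.lt_succ_iff_lt_or_eq.1 hs with hs | rfl
        · exact Or.inl ⟨s, hs, h⟩
        · exact Or.inr h

/-! ## The layout registers -/

/-- The layout registers: `r2 = n`, `r3 = n²`, `r4 = D`, `r5 = QA`, `r6 = QB`, `r7 = AA`,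
`r8 = 2n² + 2` (the query length), `r9 = QA + 1`. [folklore] -/
structure Regs (n : ℕ) (S : ℕ → ℕ) : Prop where
  r2 : S 2 = n
  r3 : S 3 = n * n
  r4 : S 4 = dD n
  r5 : S 5 = dQA n
  r6 : S 6 = dQP n
  r7 : S 7 = dQP2 n
  r8 : S 8 = 2 * (n * n) + 2
  r9 : S 9 = dQA n + 1

/-- Registers `≥ 10` do not belong to the layout. [folklore] -/
theorem Regs.of_agree {n : ℕ} {S S' : ℕ → ℕ} (h : Regs n S) (hag : ∀ r, r < 10 → S' r = S r) :
    Regs n S' :=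
  ⟨(hag 2 (by norm_num)).trans h.r2, (hag 3 (by norm_num)).trans h.r3,
    (hag 4 (by norm_num)).trans h.r4, (hag 5 (by norm_num)).trans h.r5,
    (hag 6 (by norm_num)).trans h.r6, (hag 7 (by norm_num)).trans h.r7,
    (hag 8 (by norm_num)).trans h.r8, (hag 9 (by norm_num)).trans h.r9⟩

section semantics

variable {n w : ℕ} {O : List ℕ → List ℕ} (X : Matrix (Fin n) (Fin n) (WithTop ℤ))

/-! ## Setup -/

set_option linter.unusedSimpArgs false in
/-- **The setup block.** [folklore] -/
theorem setup_spec (hF : dFREE n < 2 ^ w) (qs : List (List ℕ)) :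
    ∃ S' H' : ℕ → ℕ, Exec w O (block setupOps) ⟨merge (relocated (inp X)) (relocated (inp X)), qs⟩
        ⟨merge S' H', qs⟩ 19 ∧
      Regs n S' ∧ S' 10 = 0 ∧ S' 11 = n * n ∧ S' 15 = dD n + 2 ∧ S' 18 = dQA n + 1 ∧
      S' 19 = dQP n + 1 ∧ H' (dQA n) = n ∧ H' (dQP n) = n ∧
      ∀ a, a ≠ dQA n → a ≠ dQP n → H' a = relocated (inp X) a := by
  have hD := dD_eq n; have hQA := dQA_eq n; have hQP := dQP_eq n; have hQP2 := dQP2_eq n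
  have hOUT := dOUT_eq n; have hFR := dFREE_eq n
  have h1 : relocated (inp X) 1 = dD n := relocated_one' X
  have hDn : relocated (inp X) (dD n) = n := relocated_D X
  have hnn : n ≤ n * n := Nat.le_mul_self n
  have key : ∀ R, execOps w (merge (relocated (inp X)) (relocated (inp X))) setupOps = R →
      ∃ S' H' : ℕ → ℕ, R = merge S' H' ∧
        Regs n S' ∧ S' 10 = 0 ∧ S' 11 = n * n ∧ S' 15 = dD n + 2 ∧ S' 18 = dQA n + 1 ∧
        S' 19 = dQP n + 1 ∧ H' (dQA n) = n ∧ H' (dQP n) = n ∧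
        ∀ a, a ≠ dQA n → a ≠ dQP n → H' a = relocated (inp X) a := by
    intro R hR
    unfold setupOps at hR
    have htmp := execOps_cons_fwd hR; clear hR; obtain ⟨v1, hv1, hR⟩ := htmp
    simp -failIfUnchanged (disch := omega) only [Operand.write, Operand.read, merge_apply_of_lt,
      merge_apply_of_le, Function.update_self, Function.update_of_ne, update_merge_of_lt,
      update_merge_of_le, Nat.add_zero, BinOp.eval_mod, BinOp.eval_eq, BinOp.eval_band,
      BinOp.eval_shr, BinOp.eval_div, BinOp.eval_lt, BinOp.eval_add_of_lt, BinOp.eval_sub_of_le,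
      BinOp.eval_mul_of_lt, h1, hDn] at hv1 hR; subst hv1
    have htmp := execOps_cons_fwd hR; clear hR; obtain ⟨v2, hv2, hR⟩ := htmp
    simp -failIfUnchanged (disch := omega) only [Operand.write, Operand.read, merge_apply_of_lt,
      merge_apply_of_le, Function.update_self, Function.update_of_ne, update_merge_of_lt,
      update_merge_of_le, Nat.add_zero, BinOp.eval_mod, BinOp.eval_eq, BinOp.eval_band,
      BinOp.eval_shr, BinOp.eval_div, BinOp.eval_lt, BinOp.eval_add_of_lt, BinOp.eval_sub_of_le,
      BinOp.eval_mul_of_lt, h1] at hv2 hR; subst hv2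
    have htmp := execOps_cons_fwd hR; clear hR; obtain ⟨v3, hv3, hR⟩ := htmp
    simp -failIfUnchanged (disch := omega) only [Operand.write, Operand.read, merge_apply_of_lt,
      merge_apply_of_le, Function.update_self, Function.update_of_ne, update_merge_of_lt,
      update_merge_of_le, Nat.add_zero, BinOp.eval_mod, BinOp.eval_eq, BinOp.eval_band,
      BinOp.eval_shr, BinOp.eval_div, BinOp.eval_lt, BinOp.eval_add_of_lt, BinOp.eval_sub_of_le,
      BinOp.eval_mul_of_lt, h1] at hv3 hR; subst hv3
    have htmp := execOps_cons_fwd hR; clear hR; obtain ⟨v4, hv4, hR⟩ := htmp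
    simp -failIfUnchanged (disch := omega) only [Operand.write, Operand.read, merge_apply_of_lt,
      merge_apply_of_le, Function.update_self, Function.update_of_ne, update_merge_of_lt,
      update_merge_of_le, Nat.add_zero, BinOp.eval_mod, BinOp.eval_eq, BinOp.eval_band,
      BinOp.eval_shr, BinOp.eval_div, BinOp.eval_lt, BinOp.eval_add_of_lt, BinOp.eval_sub_of_le,
      BinOp.eval_mul_of_lt, h1] at hv4 hR; subst hv4
    have htmp := execOps_cons_fwd hR; clear hR; obtain ⟨v5, hv5, hR⟩ := htmp
    simp -failIfUnchanged (disch := omega) only [Operand.write, Operand.read, merge_apply_of_lt,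
      merge_apply_of_le, Function.update_self, Function.update_of_ne, update_merge_of_lt,
      update_merge_of_le, Nat.add_zero, BinOp.eval_mod, BinOp.eval_eq, BinOp.eval_band,
      BinOp.eval_shr, BinOp.eval_div, BinOp.eval_lt, BinOp.eval_add_of_lt, BinOp.eval_sub_of_le,
      BinOp.eval_mul_of_lt, h1] at hv5 hR; subst hv5
    have htmp := execOps_cons_fwd hR; clear hR; obtain ⟨v6, hv6, hR⟩ := htmp
    simp -failIfUnchanged (disch := omega) only [Operand.write, Operand.read, merge_apply_of_lt,
      merge_apply_of_le, Function.update_self, Function.update_of_ne, update_merge_of_lt,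
      update_merge_of_le, Nat.add_zero, BinOp.eval_mod, BinOp.eval_eq, BinOp.eval_band,
      BinOp.eval_shr, BinOp.eval_div, BinOp.eval_lt, BinOp.eval_add_of_lt, BinOp.eval_sub_of_le,
      BinOp.eval_mul_of_lt, h1] at hv6 hR; subst hv6
    have htmp := execOps_cons_fwd hR; clear hR; obtain ⟨v7, hv7, hR⟩ := htmp
    simp -failIfUnchanged (disch := omega) only [Operand.write, Operand.read, merge_apply_of_lt,
      merge_apply_of_le, Function.update_self, Function.update_of_ne, update_merge_of_lt,
      update_merge_of_le, Nat.add_zero, BinOp.eval_mod, BinOp.eval_eq, BinOp.eval_band,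
      BinOp.eval_shr, BinOp.eval_div, BinOp.eval_lt, BinOp.eval_add_of_lt, BinOp.eval_sub_of_le,
      BinOp.eval_mul_of_lt, h1] at hv7 hR; subst hv7
    have htmp := execOps_cons_fwd hR; clear hR; obtain ⟨v8, hv8, hR⟩ := htmp
    simp -failIfUnchanged (disch := omega) only [Operand.write, Operand.read, merge_apply_of_lt,
      merge_apply_of_le, Function.update_self, Function.update_of_ne, update_merge_of_lt,
      update_merge_of_le, Nat.add_zero, BinOp.eval_mod, BinOp.eval_eq, BinOp.eval_band,
      BinOp.eval_shr, BinOp.eval_div, BinOp.eval_lt, BinOp.eval_add_of_lt, BinOp.eval_sub_of_le,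
      BinOp.eval_mul_of_lt, h1] at hv8 hR; subst hv8
    have htmp := execOps_cons_fwd hR; clear hR; obtain ⟨v9, hv9, hR⟩ := htmp
    simp -failIfUnchanged (disch := omega) only [Operand.write, Operand.read, merge_apply_of_lt,
      merge_apply_of_le, Function.update_self, Function.update_of_ne, update_merge_of_lt,
      update_merge_of_le, Nat.add_zero, BinOp.eval_mod, BinOp.eval_eq, BinOp.eval_band,
      BinOp.eval_shr, BinOp.eval_div, BinOp.eval_lt, BinOp.eval_add_of_lt, BinOp.eval_sub_of_le,
      BinOp.eval_mul_of_lt, h1] at hv9 hR; subst hv9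
    have htmp := execOps_cons_fwd hR; clear hR; obtain ⟨v10, hv10, hR⟩ := htmp
    simp -failIfUnchanged (disch := omega) only [Operand.write, Operand.read, merge_apply_of_lt,
      merge_apply_of_le, Function.update_self, Function.update_of_ne, update_merge_of_lt,
      update_merge_of_le, Nat.add_zero, BinOp.eval_mod, BinOp.eval_eq, BinOp.eval_band,
      BinOp.eval_shr, BinOp.eval_div, BinOp.eval_lt, BinOp.eval_add_of_lt, BinOp.eval_sub_of_le,
      BinOp.eval_mul_of_lt, h1] at hv10 hR; subst hv10
    have htmp := execOps_cons_fwd hR; clear hR; obtain ⟨v11, hv11, hR⟩ := htmp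
    simp -failIfUnchanged (disch := omega) only [Operand.write, Operand.read, merge_apply_of_lt,
      merge_apply_of_le, Function.update_self, Function.update_of_ne, update_merge_of_lt,
      update_merge_of_le, Nat.add_zero, BinOp.eval_mod, BinOp.eval_eq, BinOp.eval_band,
      BinOp.eval_shr, BinOp.eval_div, BinOp.eval_lt, BinOp.eval_add_of_lt, BinOp.eval_sub_of_le,
      BinOp.eval_mul_of_lt, h1] at hv11 hR; subst hv11
    have htmp := execOps_cons_fwd hR; clear hR; obtain ⟨v12, hv12, hR⟩ := htmp
    simp -failIfUnchanged (disch := omega) only [Operand.write, Operand.read, merge_apply_of_lt,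
      merge_apply_of_le, Function.update_self, Function.update_of_ne, update_merge_of_lt,
      update_merge_of_le, Nat.add_zero, BinOp.eval_mod, BinOp.eval_eq, BinOp.eval_band,
      BinOp.eval_shr, BinOp.eval_div, BinOp.eval_lt, BinOp.eval_add_of_lt, BinOp.eval_sub_of_le,
      BinOp.eval_mul_of_lt, h1] at hv12 hR; subst hv12
    have htmp := execOps_cons_fwd hR; clear hR; obtain ⟨v13, hv13, hR⟩ := htmp
    simp -failIfUnchanged (disch := omega) only [Operand.write, Operand.read, merge_apply_of_lt,
      merge_apply_of_le, Function.update_self, Function.update_of_ne, update_merge_of_lt,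
      update_merge_of_le, Nat.add_zero, BinOp.eval_mod, BinOp.eval_eq, BinOp.eval_band,
      BinOp.eval_shr, BinOp.eval_div, BinOp.eval_lt, BinOp.eval_add_of_lt, BinOp.eval_sub_of_le,
      BinOp.eval_mul_of_lt, h1] at hv13 hR; subst hv13
    have htmp := execOps_cons_fwd hR; clear hR; obtain ⟨v14, hv14, hR⟩ := htmp
    simp -failIfUnchanged (disch := omega) only [Operand.write, Operand.read, merge_apply_of_lt,
      merge_apply_of_le, Function.update_self, Function.update_of_ne, update_merge_of_lt,
      update_merge_of_le, Nat.add_zero, BinOp.eval_mod, BinOp.eval_eq, BinOp.eval_band,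
      BinOp.eval_shr, BinOp.eval_div, BinOp.eval_lt, BinOp.eval_add_of_lt, BinOp.eval_sub_of_le,
      BinOp.eval_mul_of_lt, h1] at hv14 hR; subst hv14
    have htmp := execOps_cons_fwd hR; clear hR; obtain ⟨v15, hv15, hR⟩ := htmp
    simp -failIfUnchanged (disch := omega) only [Operand.write, Operand.read, merge_apply_of_lt,
      merge_apply_of_le, Function.update_self, Function.update_of_ne, update_merge_of_lt,
      update_merge_of_le, Nat.add_zero, BinOp.eval_mod, BinOp.eval_eq, BinOp.eval_band,
      BinOp.eval_shr, BinOp.eval_div, BinOp.eval_lt, BinOp.eval_add_of_lt, BinOp.eval_sub_of_le,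
      BinOp.eval_mul_of_lt, h1] at hv15 hR; subst hv15
    have htmp := execOps_cons_fwd hR; clear hR; obtain ⟨v16, hv16, hR⟩ := htmp
    simp -failIfUnchanged (disch := omega) only [Operand.write, Operand.read, merge_apply_of_lt,
      merge_apply_of_le, Function.update_self, Function.update_of_ne, update_merge_of_lt,
      update_merge_of_le, Nat.add_zero, BinOp.eval_mod, BinOp.eval_eq, BinOp.eval_band,
      BinOp.eval_shr, BinOp.eval_div, BinOp.eval_lt, BinOp.eval_add_of_lt, BinOp.eval_sub_of_le,
      BinOp.eval_mul_of_lt, h1] at hv16 hR; subst hv16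
    have htmp := execOps_cons_fwd hR; clear hR; obtain ⟨v17, hv17, hR⟩ := htmp
    simp -failIfUnchanged (disch := omega) only [Operand.write, Operand.read, merge_apply_of_lt,
      merge_apply_of_le, Function.update_self, Function.update_of_ne, update_merge_of_lt,
      update_merge_of_le, Nat.add_zero, BinOp.eval_mod, BinOp.eval_eq, BinOp.eval_band,
      BinOp.eval_shr, BinOp.eval_div, BinOp.eval_lt, BinOp.eval_add_of_lt, BinOp.eval_sub_of_le,
      BinOp.eval_mul_of_lt, h1] at hv17 hR; subst hv17
    have htmp := execOps_cons_fwd hR; clear hR; obtain ⟨v18, hv18, hR⟩ := htmp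
    simp -failIfUnchanged (disch := omega) only [Operand.write, Operand.read, merge_apply_of_lt,
      merge_apply_of_le, Function.update_self, Function.update_of_ne, update_merge_of_lt,
      update_merge_of_le, Nat.add_zero, BinOp.eval_mod, BinOp.eval_eq, BinOp.eval_band,
      BinOp.eval_shr, BinOp.eval_div, BinOp.eval_lt, BinOp.eval_add_of_lt, BinOp.eval_sub_of_le,
      BinOp.eval_mul_of_lt, h1] at hv18 hR; subst hv18
    have htmp := execOps_cons_fwd hR; clear hR; obtain ⟨v19, hv19, hR⟩ := htmp
    simp -failIfUnchanged (disch := omega) only [Operand.write, Operand.read, merge_apply_of_lt,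
      merge_apply_of_le, Function.update_self, Function.update_of_ne, update_merge_of_lt,
      update_merge_of_le, Nat.add_zero, BinOp.eval_mod, BinOp.eval_eq, BinOp.eval_band,
      BinOp.eval_shr, BinOp.eval_div, BinOp.eval_lt, BinOp.eval_add_of_lt, BinOp.eval_sub_of_le,
      BinOp.eval_mul_of_lt, h1] at hv19 hR; subst hv19
    simp only [execOps_nil] at hR; subst hR
    have e5 : dD n + n * n + 2 = dQA n := by omega
    have e7 : dD n + n * n + 2 + n * n + 1 = dQP n := by omega
    have e9 : dD n + n * n + 2 + n * n + 1 + n * n + 1 = dQP2 n := by omega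
    refine ⟨_, _, rfl, ⟨?_, ?_, ?_, ?_, ?_, ?_, ?_, ?_⟩, ?_, ?_, ?_, ?_, ?_, ?_, ?_, ?_⟩
    rotate_right 3
    · simp only [Function.update_apply]; split_ifs <;> first | rfl | omega
    · simp only [Function.update_apply]; split_ifs <;> first | rfl | omega
    · intro a h5 h7
      simp only [Function.update_apply]; split_ifs <;> first | rfl | omega
    all_goals simp only [Function.update_self, Function.update_of_ne, ne_eq, Nat.reduceEqDiff,
      not_false_eq_true]
    all_goals omega
  obtain ⟨S', H', hR, h⟩ := key _ rfl
  exact ⟨S', H', Exec.block' setupOps qs hR, h⟩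

/-! ## Loop A: the two copies of `⌜W'⌝` -/

/-- The invariant of loop A after `j` iterations: layout registers, index `j`, count `n² - j`,
the three pointers advanced by `j`, the relocated input intact, the two headers, and the first `j`
codes of `W'` written in both operand blocks. [folklore] -/
def InvA (w : ℕ) (qs : List (List ℕ)) (j : ℕ) (st : Store) : Prop :=
  ∃ S H : ℕ → ℕ, st = ⟨merge S H, qs⟩ ∧ Regs n S ∧ S 10 = j ∧ S 11 = n * n - j ∧
    S 15 = dD n + 2 + j ∧ S 18 = dQA n + 1 + j ∧ S 19 = dQP n + 1 + j ∧
    (∀ t, t < n * n → H (dD n + 2 + t) = code X t) ∧ H (dQA n) = n ∧ H (dQP n) = n ∧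
    (∀ t, t < j → H (dQA n + 1 + t) = codeZ n (code X t) t) ∧
    (∀ t, t < j → H (dQP n + 1 + t) = codeZ n (code X t) t) ∧
    dFREE n < 2 ^ w ∧ (∀ t, code X t < 2 ^ w)

set_option linter.unusedSimpArgs false in
/-- One iteration of loop A. [folklore] -/
theorem bodyA_spec {qs : List (List ℕ)} {j : ℕ} (hj : j < n * n) {st : Store}
    (hst : InvA X w qs j st) :
    ∃ st', Exec w O (block bodyA) st st' 13 ∧ InvA X w qs (j + 1) st' := by
  obtain ⟨S, H, rfl, hL, h10, h11, h15, h18, h19, hin, hqa, hqb, hA, hB, hF, hcw⟩ := hst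
  obtain ⟨h2, h3, h4, h5, h6, h7, h8, h9⟩ := hL
  have hD := dD_eq n; have hQA := dQA_eq n; have hQP := dQP_eq n; have hQP2 := dQP2_eq n
  have hOUT := dOUT_eq n; have hFR := dFREE_eq n
  have hsrc : H (dD n + 2 + j) = code X j := hin j hj
  have hcj : code X j < 2 ^ w := hcw j
  refine Exec.block_of_fwd bodyA qs fun R hR => ?_
  unfold bodyA at hR
  have htmp := execOps_cons_fwd hR; clear hR; obtain ⟨v1, hv1, hR⟩ := htmp
  simp -failIfUnchanged (disch := omega) only [Operand.write, Operand.read, merge_apply_of_lt,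
    merge_apply_of_le, Function.update_self, Function.update_of_ne, update_merge_of_lt,
    update_merge_of_le, Nat.add_zero, BinOp.eval_mod, BinOp.eval_eq, BinOp.eval_band,
    BinOp.eval_shr, BinOp.eval_div, BinOp.eval_lt, BinOp.eval_add_of_lt, BinOp.eval_sub_of_le,
    BinOp.eval_mul_of_lt, h2, h10, h11, h15, h18, h19] at hv1 hR; subst hv1
  have htmp := execOps_cons_fwd hR; clear hR; obtain ⟨v2, hv2, hR⟩ := htmp
  simp -failIfUnchanged (disch := omega) only [Operand.write, Operand.read, merge_apply_of_lt,
    merge_apply_of_le, Function.update_self, Function.update_of_ne, update_merge_of_lt,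
    update_merge_of_le, Nat.add_zero, BinOp.eval_mod, BinOp.eval_eq, BinOp.eval_band,
    BinOp.eval_shr, BinOp.eval_div, BinOp.eval_lt, BinOp.eval_add_of_lt, BinOp.eval_sub_of_le,
    BinOp.eval_mul_of_lt, h2, h10, h11, h15, h18, h19] at hv2 hR; subst hv2
  have htmp := execOps_cons_fwd hR; clear hR; obtain ⟨v3, hv3, hR⟩ := htmp
  simp -failIfUnchanged (disch := omega) only [Operand.write, Operand.read, merge_apply_of_lt,
    merge_apply_of_le, Function.update_self, Function.update_of_ne, update_merge_of_lt,
    update_merge_of_le, Nat.add_zero, BinOp.eval_mod, BinOp.eval_eq, BinOp.eval_band,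
    BinOp.eval_shr, BinOp.eval_div, BinOp.eval_lt, BinOp.eval_add_of_lt, BinOp.eval_sub_of_le,
    BinOp.eval_mul_of_lt, h2, h10, h11, h15, h18, h19] at hv3 hR
  have hv3' : v3 ≤ 1 := by rw [← hv3]; split_ifs <;> simp
  have htmp := execOps_cons_fwd hR; clear hR; obtain ⟨v4, hv4, hR⟩ := htmp
  simp -failIfUnchanged (disch := omega) only [Operand.write, Operand.read, merge_apply_of_lt,
    merge_apply_of_le, Function.update_self, Function.update_of_ne, update_merge_of_lt,
    update_merge_of_le, Nat.add_zero, BinOp.eval_mod, BinOp.eval_eq, BinOp.eval_band,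
    BinOp.eval_shr, BinOp.eval_div, BinOp.eval_lt, BinOp.eval_add_of_lt, BinOp.eval_sub_of_le,
    BinOp.eval_mul_of_lt, h2, h10, h11, h15, h18, h19] at hv4 hR
  have hv4' : v4 ≤ 1 := by rw [← hv4]; split_ifs <;> simp
  have hmul : code X j * v4 < 2 ^ w :=
    lt_of_le_of_lt (le_trans (Nat.mul_le_mul_left _ hv4') (Nat.mul_one _).le) hcj
  have htmp := execOps_cons_fwd hR; clear hR; obtain ⟨v5, hv5, hR⟩ := htmp
  simp -failIfUnchanged (disch := omega) only [Operand.write, Operand.read, merge_apply_of_lt,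
    merge_apply_of_le, Function.update_self, Function.update_of_ne, update_merge_of_lt,
    update_merge_of_le, Nat.add_zero, BinOp.eval_mod, BinOp.eval_eq, BinOp.eval_band,
    BinOp.eval_shr, BinOp.eval_div, BinOp.eval_lt, BinOp.eval_add_of_lt, BinOp.eval_sub_of_le,
    BinOp.eval_mul_of_lt, h2, h10, h11, h15, h18, h19, hsrc] at hv5 hR; subst hv5
  have htmp := execOps_cons_fwd hR; clear hR; obtain ⟨v6, hv6, hR⟩ := htmp
  simp -failIfUnchanged (disch := omega) only [Operand.write, Operand.read, merge_apply_of_lt,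
    merge_apply_of_le, Function.update_self, Function.update_of_ne, update_merge_of_lt,
    update_merge_of_le, Nat.add_zero, BinOp.eval_mod, BinOp.eval_eq, BinOp.eval_band,
    BinOp.eval_shr, BinOp.eval_div, BinOp.eval_lt, BinOp.eval_add_of_lt, BinOp.eval_sub_of_le,
    BinOp.eval_mul_of_lt, h2, h10, h11, h15, h18, h19] at hv6 hR
  have hv6w : v6 < 2 ^ w := by rw [← hv6]; exact hmul
  have htmp := execOps_cons_fwd hR; clear hR; obtain ⟨v7, hv7, hR⟩ := htmp
  simp -failIfUnchanged (disch := omega) only [Operand.write, Operand.read, merge_apply_of_lt,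
    merge_apply_of_le, Function.update_self, Function.update_of_ne, update_merge_of_lt,
    update_merge_of_le, Nat.add_zero, BinOp.eval_mod, BinOp.eval_eq, BinOp.eval_band,
    BinOp.eval_shr, BinOp.eval_div, BinOp.eval_lt, BinOp.eval_add_of_lt, BinOp.eval_sub_of_le,
    BinOp.eval_mul_of_lt, h2, h10, h11, h15, h18, h19] at hv7 hR; subst hv7
  have htmp := execOps_cons_fwd hR; clear hR; obtain ⟨v8, hv8, hR⟩ := htmp
  simp -failIfUnchanged (disch := omega) only [Operand.write, Operand.read, merge_apply_of_lt,
    merge_apply_of_le, Function.update_self, Function.update_of_ne, update_merge_of_lt,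
    update_merge_of_le, Nat.add_zero, BinOp.eval_mod, BinOp.eval_eq, BinOp.eval_band,
    BinOp.eval_shr, BinOp.eval_div, BinOp.eval_lt, BinOp.eval_add_of_lt, BinOp.eval_sub_of_le,
    BinOp.eval_mul_of_lt, h2, h10, h11, h15, h18, h19] at hv8 hR; subst hv8
  have htmp := execOps_cons_fwd hR; clear hR; obtain ⟨v9, hv9, hR⟩ := htmp
  simp -failIfUnchanged (disch := omega) only [Operand.write, Operand.read, merge_apply_of_lt,
    merge_apply_of_le, Function.update_self, Function.update_of_ne, update_merge_of_lt,
    update_merge_of_le, Nat.add_zero, BinOp.eval_mod, BinOp.eval_eq, BinOp.eval_band,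
    BinOp.eval_shr, BinOp.eval_div, BinOp.eval_lt, BinOp.eval_add_of_lt, BinOp.eval_sub_of_le,
    BinOp.eval_mul_of_lt, h2, h10, h11, h15, h18, h19] at hv9 hR; subst hv9
  have htmp := execOps_cons_fwd hR; clear hR; obtain ⟨v10, hv10, hR⟩ := htmp
  simp -failIfUnchanged (disch := omega) only [Operand.write, Operand.read, merge_apply_of_lt,
    merge_apply_of_le, Function.update_self, Function.update_of_ne, update_merge_of_lt,
    update_merge_of_le, Nat.add_zero, BinOp.eval_mod, BinOp.eval_eq, BinOp.eval_band,
    BinOp.eval_shr, BinOp.eval_div, BinOp.eval_lt, BinOp.eval_add_of_lt, BinOp.eval_sub_of_le,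
    BinOp.eval_mul_of_lt, h2, h10, h11, h15, h18, h19] at hv10 hR; subst hv10
  have htmp := execOps_cons_fwd hR; clear hR; obtain ⟨v11, hv11, hR⟩ := htmp
  simp -failIfUnchanged (disch := omega) only [Operand.write, Operand.read, merge_apply_of_lt,
    merge_apply_of_le, Function.update_self, Function.update_of_ne, update_merge_of_lt,
    update_merge_of_le, Nat.add_zero, BinOp.eval_mod, BinOp.eval_eq, BinOp.eval_band,
    BinOp.eval_shr, BinOp.eval_div, BinOp.eval_lt, BinOp.eval_add_of_lt, BinOp.eval_sub_of_le,
    BinOp.eval_mul_of_lt, h2, h10, h11, h15, h18, h19] at hv11 hR; subst hv11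
  have htmp := execOps_cons_fwd hR; clear hR; obtain ⟨v12, hv12, hR⟩ := htmp
  simp -failIfUnchanged (disch := omega) only [Operand.write, Operand.read, merge_apply_of_lt,
    merge_apply_of_le, Function.update_self, Function.update_of_ne, update_merge_of_lt,
    update_merge_of_le, Nat.add_zero, BinOp.eval_mod, BinOp.eval_eq, BinOp.eval_band,
    BinOp.eval_shr, BinOp.eval_div, BinOp.eval_lt, BinOp.eval_add_of_lt, BinOp.eval_sub_of_le,
    BinOp.eval_mul_of_lt, h2, h10, h11, h15, h18, h19] at hv12 hR; subst hv12
  have htmp := execOps_cons_fwd hR; clear hR; obtain ⟨v13, hv13, hR⟩ := htmp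
  simp -failIfUnchanged (disch := omega) only [Operand.write, Operand.read, merge_apply_of_lt,
    merge_apply_of_le, Function.update_self, Function.update_of_ne, update_merge_of_lt,
    update_merge_of_le, Nat.add_zero, BinOp.eval_mod, BinOp.eval_eq, BinOp.eval_band,
    BinOp.eval_shr, BinOp.eval_div, BinOp.eval_lt, BinOp.eval_add_of_lt, BinOp.eval_sub_of_le,
    BinOp.eval_mul_of_lt, h2, h10, h11, h15, h18, h19] at hv13 hR; subst hv13
  simp only [execOps_nil] at hR; subst hR
  -- the written code
  have hval : v6 = codeZ n (code X j) j := by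
    rw [← hv6, ← hv4, ← hv3, codeZ]
    by_cases hd : j / n = j % n
    · simp [hd]
    · simp [hd]
  refine ⟨_, _, rfl, ⟨?_, ?_, ?_, ?_, ?_, ?_, ?_, ?_⟩, ?_, ?_, ?_, ?_, ?_, ?_, ?_, ?_, ?_, ?_, hF, hcw⟩
  all_goals try simp only [Function.update_self, Function.update_of_ne, ne_eq, Nat.reduceEqDiff,
      not_false_eq_true, h2, h3, h4, h5, h6, h7, h8, h9, h10, h11]
  all_goals try omega
  · -- input intact
    intro t ht
    rw [Function.update_of_ne (by omega), Function.update_of_ne (by omega), hin t ht]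
  · rw [Function.update_of_ne (by omega), Function.update_of_ne (by omega), hqa]
  · rw [Function.update_of_ne (by omega), Function.update_of_ne (by omega), hqb]
  · intro t ht
    rcases Nat.lt_succ_iff_lt_or_eq.1 ht with ht | rfl
    · rw [Function.update_of_ne (by omega), Function.update_of_ne (by omega), hA t ht]
    · rw [Function.update_of_ne (by omega), Function.update_self, hval]
  · intro t ht
    rcases Nat.lt_succ_iff_lt_or_eq.1 ht with ht | rfl
    · rw [Function.update_of_ne (by omega), Function.update_of_ne (by omega), hB t ht]
    · rw [Function.update_self, hval]

/-- **Loop A.** [folklore] -/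
theorem loopA_spec {qs : List (List ℕ)} {st : Store} (hst : InvA X w qs 0 st) :
    ∃ st', ExecLE w O (whilenz (.dir 11) (block bodyA)) st st' (n * n * 15 + 1) ∧
      InvA X w qs (n * n) st' := by
  refine ExecLE.whilenz_invariant (n * n) 13 (InvA X w qs) (fun i hi st hst => ⟨?_, ?_⟩) ?_ hst
  · obtain ⟨S, H, rfl, -, -, h11, -⟩ := hst
    show merge S H 11 ≠ 0
    rw [merge_apply_of_lt (by norm_num), h11]; omega
  · obtain ⟨st', hex, hst'⟩ := bodyA_spec X hi hst
    exact ⟨st', hex.execLE, hst'⟩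
  · intro st hst
    obtain ⟨S, H, rfl, -, -, h11, -⟩ := hst
    show merge S H 11 = 0
    rw [merge_apply_of_lt (by norm_num), h11]; omega

end semantics

/-! ## After the query: loop C and the output -/

section loopC

variable {n w : ℕ} {O : List ℕ → List ℕ} (H₁ : ℕ → ℕ) (qs₁ : List (List ℕ)) (pv qv : ℕ → ℕ)

/-- The invariant of loop C after `j` iterations (over the fixed data `H₁` holding the query blocks
and the oracle's answer, and the fixed query log `qs₁`): layout registers, index `j`, count
`n² - j`, the flag `flagW pv qv j` and the answer pointer `AA + 2 + j`. [folklore] -/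
def InvC (j : ℕ) (st : Store) : Prop :=
  ∃ S : ℕ → ℕ, st = ⟨merge S H₁, qs₁⟩ ∧ Regs n S ∧ S 10 = j ∧ S 11 = n * n - j ∧
    S 17 = flagW pv qv j ∧ S 20 = dQP2 n + 2 + j

set_option linter.unusedSimpArgs false in
/-- **The block after the query** establishes the invariant of loop C. [folklore] -/
theorem postOps_spec {S : ℕ → ℕ} (hL : Regs n S) (hF : dFREE n < 2 ^ w) :
    ∃ st', Exec w O (block postOps) ⟨merge S H₁, qs₁⟩ st' 4 ∧ InvC (n := n) H₁ qs₁ pv qv 0 st' := by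
  obtain ⟨h2, h3, h4, h5, h6, h7, h8, h9⟩ := hL
  have hD := dD_eq n; have hQA := dQA_eq n; have hQP := dQP_eq n; have hQP2 := dQP2_eq n
  have hOUT := dOUT_eq n; have hFR := dFREE_eq n
  refine Exec.block_of_fwd postOps qs₁ fun R hR => ?_
  unfold postOps at hR
  have htmp := execOps_cons_fwd hR; clear hR; obtain ⟨v1, hv1, hR⟩ := htmp
  simp -failIfUnchanged (disch := omega) only [Operand.write, Operand.read, merge_apply_of_lt,
    merge_apply_of_le, Function.update_self, Function.update_of_ne, update_merge_of_lt,
    update_merge_of_le, Nat.add_zero, BinOp.eval_mod, BinOp.eval_eq, BinOp.eval_band,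
    BinOp.eval_shr, BinOp.eval_div, BinOp.eval_lt, BinOp.eval_add_of_lt, BinOp.eval_sub_of_le,
    BinOp.eval_mul_of_lt, h2, h3, h7] at hv1 hR; subst hv1
  have htmp := execOps_cons_fwd hR; clear hR; obtain ⟨v2, hv2, hR⟩ := htmp
  simp -failIfUnchanged (disch := omega) only [Operand.write, Operand.read, merge_apply_of_lt,
    merge_apply_of_le, Function.update_self, Function.update_of_ne, update_merge_of_lt,
    update_merge_of_le, Nat.add_zero, BinOp.eval_mod, BinOp.eval_eq, BinOp.eval_band,
    BinOp.eval_shr, BinOp.eval_div, BinOp.eval_lt, BinOp.eval_add_of_lt, BinOp.eval_sub_of_le,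
    BinOp.eval_mul_of_lt, h2, h3, h7] at hv2 hR; subst hv2
  have htmp := execOps_cons_fwd hR; clear hR; obtain ⟨v3, hv3, hR⟩ := htmp
  simp -failIfUnchanged (disch := omega) only [Operand.write, Operand.read, merge_apply_of_lt,
    merge_apply_of_le, Function.update_self, Function.update_of_ne, update_merge_of_lt,
    update_merge_of_le, Nat.add_zero, BinOp.eval_mod, BinOp.eval_eq, BinOp.eval_band,
    BinOp.eval_shr, BinOp.eval_div, BinOp.eval_lt, BinOp.eval_add_of_lt, BinOp.eval_sub_of_le,
    BinOp.eval_mul_of_lt, h2, h3, h7] at hv3 hR; subst hv3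
  have htmp := execOps_cons_fwd hR; clear hR; obtain ⟨v4, hv4, hR⟩ := htmp
  simp -failIfUnchanged (disch := omega) only [Operand.write, Operand.read, merge_apply_of_lt,
    merge_apply_of_le, Function.update_self, Function.update_of_ne, update_merge_of_lt,
    update_merge_of_le, Nat.add_zero, BinOp.eval_mod, BinOp.eval_eq, BinOp.eval_band,
    BinOp.eval_shr, BinOp.eval_div, BinOp.eval_lt, BinOp.eval_add_of_lt, BinOp.eval_sub_of_le,
    BinOp.eval_mul_of_lt, h2, h3, h7] at hv4 hR; subst hv4
  simp only [execOps_nil] at hR; subst hR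
  refine ⟨_, rfl, ⟨?_, ?_, ?_, ?_, ?_, ?_, ?_, ?_⟩, ?_, ?_, ?_, ?_⟩
  all_goals simp only [Function.update_self, Function.update_of_ne, ne_eq, Nat.reduceEqDiff,
      not_false_eq_true, h2, h3, h4, h5, h6, h7, h8, h9, flagW]
  all_goals omega

variable (hpv : ∀ t, t < n * n → H₁ (dQP2 n + 2 + t) = pv t)
  (hqv : ∀ t, t < n * n → H₁ (dQA n + 1 + (t % n * n + t / n)) = qv t)
  (hpw : ∀ t, t < n * n → pv t < 2 ^ w) (hqw : ∀ t, t < n * n → qv t < 2 ^ w)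
  (hF : dFREE n < 2 ^ w)

include hpv hqv hpw hqw hF in
set_option linter.unusedSimpArgs false in
/-- One iteration of loop C. [folklore] -/
theorem bodyC_spec {j : ℕ} (hj : j < n * n) {st : Store} (hst : InvC (n := n) H₁ qs₁ pv qv j st) :
    ∃ st', Exec w O (block bodyC) st st' 24 ∧ InvC (n := n) H₁ qs₁ pv qv (j + 1) st' := by
  obtain ⟨S, rfl, hL, h10, h11, h17, h20⟩ := hst
  obtain ⟨h2, h3, h4, h5, h6, h7, h8, h9⟩ := hL
  have hD := dD_eq n; have hQA := dQA_eq n; have hQP := dQP_eq n; have hQP2 := dQP2_eq n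
  have hOUT := dOUT_eq n; have hFR := dFREE_eq n
  have hn : 0 < n := Nat.pos_of_ne_zero fun h0 => by subst h0; simp at hj
  have hjd : j / n < n := Nat.div_lt_of_lt_mul (by rwa [Nat.mul_comm] at hj)
  have hjm : j % n < n := Nat.mod_lt _ hn
  have hp : H₁ (dQP2 n + 2 + j) = pv j := hpv j hj
  have hpj : pv j < 2 ^ w := hpw j hj
  have hqj : qv j < 2 ^ w := hqw j hj
  have hfl : flagW pv qv j ≤ 1 := flagW_le_one pv qv j
  refine Exec.block_of_fwd bodyC qs₁ fun R hR => ?_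
  unfold bodyC at hR
  -- 0: i := t / n  (kept as an opaque register value `v1`, for `omega`)
  have htmp := execOps_cons_fwd hR; clear hR; obtain ⟨v1, hv1, hR⟩ := htmp
  simp -failIfUnchanged (disch := omega) only [Operand.write, Operand.read, merge_apply_of_lt,
    merge_apply_of_le, Function.update_self, Function.update_of_ne, update_merge_of_lt,
    update_merge_of_le, Nat.add_zero, BinOp.eval_mod, BinOp.eval_eq, BinOp.eval_band,
    BinOp.eval_shr, BinOp.eval_div, BinOp.eval_lt, BinOp.eval_add_of_lt, BinOp.eval_sub_of_le,
    BinOp.eval_mul_of_lt, h2, h9, h10, h11, h17, h20] at hv1 hR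
  -- 1: j := t % n
  have htmp := execOps_cons_fwd hR; clear hR; obtain ⟨v2, hv2, hR⟩ := htmp
  simp -failIfUnchanged (disch := omega) only [Operand.write, Operand.read, merge_apply_of_lt,
    merge_apply_of_le, Function.update_self, Function.update_of_ne, update_merge_of_lt,
    update_merge_of_le, Nat.add_zero, BinOp.eval_mod, BinOp.eval_eq, BinOp.eval_band,
    BinOp.eval_shr, BinOp.eval_div, BinOp.eval_lt, BinOp.eval_add_of_lt, BinOp.eval_sub_of_le,
    BinOp.eval_mul_of_lt, h2, h9, h10, h11, h17, h20] at hv2 hR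
  have hoff : v2 * n + v1 < n * n := by
    rw [← hv1, ← hv2]; exact NegTriToAPSP.mul_add_lt_mul hjm hjd
  have hq : H₁ (v2 * n + v1 + (dQA n + 1)) = qv j := by
    have := hqv j hj
    rw [hv1, hv2] at this
    rwa [show v2 * n + v1 + (dQA n + 1) = dQA n + 1 + (v2 * n + v1) by omega]
  -- 2: j n
  have htmp := execOps_cons_fwd hR; clear hR; obtain ⟨v3, hv3, hR⟩ := htmp
  simp -failIfUnchanged (disch := omega) only [Operand.write, Operand.read, merge_apply_of_lt,
    merge_apply_of_le, Function.update_self, Function.update_of_ne, update_merge_of_lt,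
    update_merge_of_le, Nat.add_zero, BinOp.eval_mod, BinOp.eval_eq, BinOp.eval_band,
    BinOp.eval_shr, BinOp.eval_div, BinOp.eval_lt, BinOp.eval_add_of_lt, BinOp.eval_sub_of_le,
    BinOp.eval_mul_of_lt, h2, h9, h10, h11, h17, h20] at hv3 hR; subst hv3
  -- 3: j n + i
  have htmp := execOps_cons_fwd hR; clear hR; obtain ⟨v4, hv4, hR⟩ := htmp
  simp -failIfUnchanged (disch := omega) only [Operand.write, Operand.read, merge_apply_of_lt,
    merge_apply_of_le, Function.update_self, Function.update_of_ne, update_merge_of_lt,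
    update_merge_of_le, Nat.add_zero, BinOp.eval_mod, BinOp.eval_eq, BinOp.eval_band,
    BinOp.eval_shr, BinOp.eval_div, BinOp.eval_lt, BinOp.eval_add_of_lt, BinOp.eval_sub_of_le,
    BinOp.eval_mul_of_lt, h2, h9, h10, h11, h17, h20] at hv4 hR; subst hv4
  -- 4: the query-code address
  have htmp := execOps_cons_fwd hR; clear hR; obtain ⟨v5, hv5, hR⟩ := htmp
  simp -failIfUnchanged (disch := omega) only [Operand.write, Operand.read, merge_apply_of_lt,
    merge_apply_of_le, Function.update_self, Function.update_of_ne, update_merge_of_lt,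
    update_merge_of_le, Nat.add_zero, BinOp.eval_mod, BinOp.eval_eq, BinOp.eval_band,
    BinOp.eval_shr, BinOp.eval_div, BinOp.eval_lt, BinOp.eval_add_of_lt, BinOp.eval_sub_of_le,
    BinOp.eval_mul_of_lt, h2, h9, h10, h11, h17, h20] at hv5 hR; subst hv5
  -- 5: q
  have htmp := execOps_cons_fwd hR; clear hR; obtain ⟨v6, hv6, hR⟩ := htmp
  simp -failIfUnchanged (disch := omega) only [Operand.write, Operand.read, merge_apply_of_lt,
    merge_apply_of_le, Function.update_self, Function.update_of_ne, update_merge_of_lt,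
    update_merge_of_le, Nat.add_zero, BinOp.eval_mod, BinOp.eval_eq, BinOp.eval_band,
    BinOp.eval_shr, BinOp.eval_div, BinOp.eval_lt, BinOp.eval_add_of_lt, BinOp.eval_sub_of_le,
    BinOp.eval_mul_of_lt, h2, h9, h10, h11, h17, h20, hq] at hv6 hR; subst hv6
  -- 6: p
  have htmp := execOps_cons_fwd hR; clear hR; obtain ⟨v7, hv7, hR⟩ := htmp
  simp -failIfUnchanged (disch := omega) only [Operand.write, Operand.read, merge_apply_of_lt,
    merge_apply_of_le, Function.update_self, Function.update_of_ne, update_merge_of_lt,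
    update_merge_of_le, Nat.add_zero, BinOp.eval_mod, BinOp.eval_eq, BinOp.eval_band,
    BinOp.eval_shr, BinOp.eval_div, BinOp.eval_lt, BinOp.eval_add_of_lt, BinOp.eval_sub_of_le,
    BinOp.eval_mul_of_lt, h2, h9, h10, h11, h17, h20, hp] at hv7 hR; subst hv7
  -- 7: sel := [p < q]
  have htmp := execOps_cons_fwd hR; clear hR; obtain ⟨v8, hv8, hR⟩ := htmp
  simp -failIfUnchanged (disch := omega) only [Operand.write, Operand.read, merge_apply_of_lt,
    merge_apply_of_le, Function.update_self, Function.update_of_ne, update_merge_of_lt,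
    update_merge_of_le, Nat.add_zero, BinOp.eval_mod, BinOp.eval_eq, BinOp.eval_band,
    BinOp.eval_shr, BinOp.eval_div, BinOp.eval_lt, BinOp.eval_add_of_lt, BinOp.eval_sub_of_le,
    BinOp.eval_mul_of_lt, h2, h9, h10, h11, h17, h20] at hv8 hR
  have hv8s : v8 = selW (pv j) (qv j) := by rw [← hv8, selW]
  have hv8' : v8 ≤ 1 := hv8s ▸ selW_le_one _ _
  have hm1 : qv j * v8 < 2 ^ w :=
    lt_of_le_of_lt (le_trans (Nat.mul_le_mul_left _ hv8') (Nat.mul_one _).le) hqj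
  have hm2 : pv j * (1 - v8) < 2 ^ w :=
    lt_of_le_of_lt (le_trans (Nat.mul_le_mul_left _ (Nat.sub_le 1 v8)) (Nat.mul_one _).le) hpj
  -- 8: q sel
  have htmp := execOps_cons_fwd hR; clear hR; obtain ⟨v9, hv9, hR⟩ := htmp
  simp -failIfUnchanged (disch := omega) only [Operand.write, Operand.read, merge_apply_of_lt,
    merge_apply_of_le, Function.update_self, Function.update_of_ne, update_merge_of_lt,
    update_merge_of_le, Nat.add_zero, BinOp.eval_mod, BinOp.eval_eq, BinOp.eval_band,
    BinOp.eval_shr, BinOp.eval_div, BinOp.eval_lt, BinOp.eval_add_of_lt, BinOp.eval_sub_of_le,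
    BinOp.eval_mul_of_lt, h2, h9, h10, h11, h17, h20] at hv9 hR
  have hv9' : v9 ≤ qv j := by
    rw [← hv9]; exact le_trans (Nat.mul_le_mul_left _ hv8') (Nat.mul_one _).le
  -- 9: 1 - sel
  have htmp := execOps_cons_fwd hR; clear hR; obtain ⟨v10, hv10, hR⟩ := htmp
  simp -failIfUnchanged (disch := omega) only [Operand.write, Operand.read, merge_apply_of_lt,
    merge_apply_of_le, Function.update_self, Function.update_of_ne, update_merge_of_lt,
    update_merge_of_le, Nat.add_zero, BinOp.eval_mod, BinOp.eval_eq, BinOp.eval_band,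
    BinOp.eval_shr, BinOp.eval_div, BinOp.eval_lt, BinOp.eval_add_of_lt, BinOp.eval_sub_of_le,
    BinOp.eval_mul_of_lt, h2, h9, h10, h11, h17, h20] at hv10 hR; subst hv10
  -- 10: p (1 - sel)
  have htmp := execOps_cons_fwd hR; clear hR; obtain ⟨v11, hv11, hR⟩ := htmp
  simp -failIfUnchanged (disch := omega) only [Operand.write, Operand.read, merge_apply_of_lt,
    merge_apply_of_le, Function.update_self, Function.update_of_ne, update_merge_of_lt,
    update_merge_of_le, Nat.add_zero, BinOp.eval_mod, BinOp.eval_eq, BinOp.eval_band,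
    BinOp.eval_shr, BinOp.eval_div, BinOp.eval_lt, BinOp.eval_add_of_lt, BinOp.eval_sub_of_le,
    BinOp.eval_mul_of_lt, h2, h9, h10, h11, h17, h20] at hv11 hR
  have hv11' : v11 ≤ pv j := by
    rw [← hv11]; exact le_trans (Nat.mul_le_mul_left _ (Nat.sub_le 1 v8)) (Nat.mul_one _).le
  have hsum : v9 + v11 < 2 ^ w := by
    rcases Nat.le_one_iff_eq_zero_or_eq_one.1 hv8' with h8 | h8
    · rw [← hv9, ← hv11, h8]; simpa using hpj
    · rw [← hv9, ← hv11, h8]; simpa using hqj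
  -- 11: max p q
  have htmp := execOps_cons_fwd hR; clear hR; obtain ⟨v12, hv12, hR⟩ := htmp
  simp -failIfUnchanged (disch := omega) only [Operand.write, Operand.read, merge_apply_of_lt,
    merge_apply_of_le, Function.update_self, Function.update_of_ne, update_merge_of_lt,
    update_merge_of_le, Nat.add_zero, BinOp.eval_mod, BinOp.eval_eq, BinOp.eval_band,
    BinOp.eval_shr, BinOp.eval_div, BinOp.eval_lt, BinOp.eval_add_of_lt, BinOp.eval_sub_of_le,
    BinOp.eval_mul_of_lt, h2, h9, h10, h11, h17, h20] at hv12 hR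
  -- 12: parity of the max
  have htmp := execOps_cons_fwd hR; clear hR; obtain ⟨v13, hv13, hR⟩ := htmp
  simp -failIfUnchanged (disch := omega) only [Operand.write, Operand.read, merge_apply_of_lt,
    merge_apply_of_le, Function.update_self, Function.update_of_ne, update_merge_of_lt,
    update_merge_of_le, Nat.add_zero, BinOp.eval_mod, BinOp.eval_eq, BinOp.eval_band,
    BinOp.eval_shr, BinOp.eval_div, BinOp.eval_lt, BinOp.eval_add_of_lt, BinOp.eval_sub_of_le,
    BinOp.eval_mul_of_lt, h2, h9, h10, h11, h17, h20] at hv13 hR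
  -- 13: [max even]
  have htmp := execOps_cons_fwd hR; clear hR; obtain ⟨v14, hv14, hR⟩ := htmp
  simp -failIfUnchanged (disch := omega) only [Operand.write, Operand.read, merge_apply_of_lt,
    merge_apply_of_le, Function.update_self, Function.update_of_ne, update_merge_of_lt,
    update_merge_of_le, Nat.add_zero, BinOp.eval_mod, BinOp.eval_eq, BinOp.eval_band,
    BinOp.eval_shr, BinOp.eval_div, BinOp.eval_lt, BinOp.eval_add_of_lt, BinOp.eval_sub_of_le,
    BinOp.eval_mul_of_lt, h2, h9, h10, h11, h17, h20] at hv14 hR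
  -- 14: [p = 0]
  have htmp := execOps_cons_fwd hR; clear hR; obtain ⟨v15, hv15, hR⟩ := htmp
  simp -failIfUnchanged (disch := omega) only [Operand.write, Operand.read, merge_apply_of_lt,
    merge_apply_of_le, Function.update_self, Function.update_of_ne, update_merge_of_lt,
    update_merge_of_le, Nat.add_zero, BinOp.eval_mod, BinOp.eval_eq, BinOp.eval_band,
    BinOp.eval_shr, BinOp.eval_div, BinOp.eval_lt, BinOp.eval_add_of_lt, BinOp.eval_sub_of_le,
    BinOp.eval_mul_of_lt, h2, h9, h10, h11, h17, h20] at hv15 hR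
  -- 15: [p ≠ 0]
  have htmp := execOps_cons_fwd hR; clear hR; obtain ⟨v16, hv16, hR⟩ := htmp
  simp -failIfUnchanged (disch := omega) only [Operand.write, Operand.read, merge_apply_of_lt,
    merge_apply_of_le, Function.update_self, Function.update_of_ne, update_merge_of_lt,
    update_merge_of_le, Nat.add_zero, BinOp.eval_mod, BinOp.eval_eq, BinOp.eval_band,
    BinOp.eval_shr, BinOp.eval_div, BinOp.eval_lt, BinOp.eval_add_of_lt, BinOp.eval_sub_of_le,
    BinOp.eval_mul_of_lt, h2, h9, h10, h11, h17, h20] at hv16 hR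
  -- 16: [q = 0]
  have htmp := execOps_cons_fwd hR; clear hR; obtain ⟨v17, hv17', hR⟩ := htmp
  simp -failIfUnchanged (disch := omega) only [Operand.write, Operand.read, merge_apply_of_lt,
    merge_apply_of_le, Function.update_self, Function.update_of_ne, update_merge_of_lt,
    update_merge_of_le, Nat.add_zero, BinOp.eval_mod, BinOp.eval_eq, BinOp.eval_band,
    BinOp.eval_shr, BinOp.eval_div, BinOp.eval_lt, BinOp.eval_add_of_lt, BinOp.eval_sub_of_le,
    BinOp.eval_mul_of_lt, h2, h9, h10, h11, h17, h20] at hv17' hR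
  -- 17: [q ≠ 0]
  have htmp := execOps_cons_fwd hR; clear hR; obtain ⟨v18, hv18, hR⟩ := htmp
  simp -failIfUnchanged (disch := omega) only [Operand.write, Operand.read, merge_apply_of_lt,
    merge_apply_of_le, Function.update_self, Function.update_of_ne, update_merge_of_lt,
    update_merge_of_le, Nat.add_zero, BinOp.eval_mod, BinOp.eval_eq, BinOp.eval_band,
    BinOp.eval_shr, BinOp.eval_div, BinOp.eval_lt, BinOp.eval_add_of_lt, BinOp.eval_sub_of_le,
    BinOp.eval_mul_of_lt, h2, h9, h10, h11, h17, h20] at hv18 hR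
  -- 18: [p ≠ 0 ∧ q ≠ 0]
  have htmp := execOps_cons_fwd hR; clear hR; obtain ⟨v19, hv19, hR⟩ := htmp
  simp -failIfUnchanged (disch := omega) only [Operand.write, Operand.read, merge_apply_of_lt,
    merge_apply_of_le, Function.update_self, Function.update_of_ne, update_merge_of_lt,
    update_merge_of_le, Nat.add_zero, BinOp.eval_mod, BinOp.eval_eq, BinOp.eval_band,
    BinOp.eval_shr, BinOp.eval_div, BinOp.eval_lt, BinOp.eval_add_of_lt, BinOp.eval_sub_of_le,
    BinOp.eval_mul_of_lt, h2, h9, h10, h11, h17, h20] at hv19 hR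
  -- 19: the test word
  have htmp := execOps_cons_fwd hR; clear hR; obtain ⟨v20, hv20, hR⟩ := htmp
  simp -failIfUnchanged (disch := omega) only [Operand.write, Operand.read, merge_apply_of_lt,
    merge_apply_of_le, Function.update_self, Function.update_of_ne, update_merge_of_lt,
    update_merge_of_le, Nat.add_zero, BinOp.eval_mod, BinOp.eval_eq, BinOp.eval_band,
    BinOp.eval_shr, BinOp.eval_div, BinOp.eval_lt, BinOp.eval_add_of_lt, BinOp.eval_sub_of_le,
    BinOp.eval_mul_of_lt, h2, h9, h10, h11, h17, h20] at hv20 hR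
  have htest : v20 = negTest (pv j) (qv j) := by
    rw [← hv20, ← hv19, ← hv18, ← hv17', ← hv16, ← hv15, ← hv14, ← hv13, ← hv12, ← hv11, ← hv9,
      hv8s, negTest]
  have hv20' : v20 ≤ 1 := htest ▸ negTest_le_one _ _
  have hbor : BinOp.bor.eval w (flagW pv qv j) v20 = flagW pv qv j ||| v20 :=
    BinOp.eval_bor_of_lt (by omega) (by omega)
  -- 20: the flag
  have htmp := execOps_cons_fwd hR; clear hR; obtain ⟨v21, hv21, hR⟩ := htmp
  simp -failIfUnchanged (disch := omega) only [Operand.write, Operand.read, merge_apply_of_lt,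
    merge_apply_of_le, Function.update_self, Function.update_of_ne, update_merge_of_lt,
    update_merge_of_le, Nat.add_zero, BinOp.eval_mod, BinOp.eval_eq, BinOp.eval_band,
    BinOp.eval_shr, BinOp.eval_div, BinOp.eval_lt, BinOp.eval_add_of_lt, BinOp.eval_sub_of_le,
    BinOp.eval_mul_of_lt, h2, h9, h10, h11, h17, h20, hbor] at hv21 hR
  have hflag : v21 = flagW pv qv (j + 1) := by rw [← hv21, htest, flagW]
  have hv21' : v21 ≤ 1 := hflag ▸ flagW_le_one _ _ _
  -- 21–23: pointer, index, count
  have htmp := execOps_cons_fwd hR; clear hR; obtain ⟨v22, hv22, hR⟩ := htmp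
  simp -failIfUnchanged (disch := omega) only [Operand.write, Operand.read, merge_apply_of_lt,
    merge_apply_of_le, Function.update_self, Function.update_of_ne, update_merge_of_lt,
    update_merge_of_le, Nat.add_zero, BinOp.eval_mod, BinOp.eval_eq, BinOp.eval_band,
    BinOp.eval_shr, BinOp.eval_div, BinOp.eval_lt, BinOp.eval_add_of_lt, BinOp.eval_sub_of_le,
    BinOp.eval_mul_of_lt, h2, h9, h10, h11, h17, h20] at hv22 hR; subst hv22
  have htmp := execOps_cons_fwd hR; clear hR; obtain ⟨v23, hv23, hR⟩ := htmp
  simp -failIfUnchanged (disch := omega) only [Operand.write, Operand.read, merge_apply_of_lt,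
    merge_apply_of_le, Function.update_self, Function.update_of_ne, update_merge_of_lt,
    update_merge_of_le, Nat.add_zero, BinOp.eval_mod, BinOp.eval_eq, BinOp.eval_band,
    BinOp.eval_shr, BinOp.eval_div, BinOp.eval_lt, BinOp.eval_add_of_lt, BinOp.eval_sub_of_le,
    BinOp.eval_mul_of_lt, h2, h9, h10, h11, h17, h20] at hv23 hR; subst hv23
  have htmp := execOps_cons_fwd hR; clear hR; obtain ⟨v24, hv24, hR⟩ := htmp
  simp -failIfUnchanged (disch := omega) only [Operand.write, Operand.read, merge_apply_of_lt,
    merge_apply_of_le, Function.update_self, Function.update_of_ne, update_merge_of_lt,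
    update_merge_of_le, Nat.add_zero, BinOp.eval_mod, BinOp.eval_eq, BinOp.eval_band,
    BinOp.eval_shr, BinOp.eval_div, BinOp.eval_lt, BinOp.eval_add_of_lt, BinOp.eval_sub_of_le,
    BinOp.eval_mul_of_lt, h2, h9, h10, h11, h17, h20] at hv24 hR; subst hv24
  simp only [execOps_nil] at hR; subst hR
  refine ⟨_, rfl, ⟨?_, ?_, ?_, ?_, ?_, ?_, ?_, ?_⟩, ?_, ?_, ?_, ?_⟩
  all_goals simp only [Function.update_self, Function.update_of_ne, ne_eq, Nat.reduceEqDiff,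
      not_false_eq_true, h2, h3, h4, h5, h6, h7, h8, h9, h10, h11, hflag]
  all_goals omega

include hpv hqv hpw hqw hF in
/-- **Loop C.** [folklore] -/
theorem loopC_spec {st : Store} (hst : InvC (n := n) H₁ qs₁ pv qv 0 st) :
    ∃ st', ExecLE w O (whilenz (.dir 11) (block bodyC)) st st' (n * n * 26 + 1) ∧
      InvC (n := n) H₁ qs₁ pv qv (n * n) st' := by
  refine ExecLE.whilenz_invariant (n * n) 24 (InvC (n := n) H₁ qs₁ pv qv)
    (fun i hi st hst => ⟨?_, ?_⟩) ?_ hst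
  · obtain ⟨S, rfl, -, -, h11, -⟩ := hst
    show merge S H₁ 11 ≠ 0
    rw [merge_apply_of_lt (by norm_num), h11]; omega
  · obtain ⟨st', hex, hst'⟩ := bodyC_spec H₁ qs₁ pv qv hpv hqv hpw hqw hF hi hst
    exact ⟨st', hex.execLE, hst'⟩
  · intro st hst
    obtain ⟨S, rfl, -, -, h11, -⟩ := hst
    show merge S H₁ 11 = 0
    rw [merge_apply_of_lt (by norm_num), h11]; omega

set_option linter.unusedSimpArgs false in
/-- **The output block**: `mem[1] := flag`, `mem[0] := 1`. [folklore] -/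
theorem finOps_spec (hF : dFREE n < 2 ^ w) {st : Store}
    (hst : InvC (n := n) H₁ qs₁ pv qv (n * n) st) :
    ∃ S' : ℕ → ℕ, Exec w O (block finOps) st ⟨merge S' H₁, qs₁⟩ 2 ∧ S' 0 = 1 ∧
      S' 1 = flagW pv qv (n * n) := by
  obtain ⟨S, rfl, hL, h10, h11, h17, h20⟩ := hst
  have hFR := dFREE_eq n
  have hfl : flagW pv qv (n * n) ≤ 1 := flagW_le_one pv qv _
  obtain ⟨st', hex, S', rfl, h0, h1⟩ : ∃ st', Exec w O (block finOps) ⟨merge S H₁, qs₁⟩ st' 2 ∧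
      ∃ S', st' = ⟨merge S' H₁, qs₁⟩ ∧ S' 0 = 1 ∧ S' 1 = flagW pv qv (n * n) := by
    refine Exec.block_of_fwd finOps qs₁ fun R hR => ?_
    unfold finOps at hR
    have htmp := execOps_cons_fwd hR; clear hR; obtain ⟨v1, hv1, hR⟩ := htmp
    simp -failIfUnchanged (disch := omega) only [Operand.write, Operand.read, merge_apply_of_lt,
      merge_apply_of_le, Function.update_self, Function.update_of_ne, update_merge_of_lt,
      update_merge_of_le, Nat.add_zero, BinOp.eval_mod, BinOp.eval_eq, BinOp.eval_band,
      BinOp.eval_shr, BinOp.eval_div, BinOp.eval_lt, BinOp.eval_add_of_lt, BinOp.eval_sub_of_le,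
      BinOp.eval_mul_of_lt, h17] at hv1 hR; subst hv1
    have htmp := execOps_cons_fwd hR; clear hR; obtain ⟨v2, hv2, hR⟩ := htmp
    simp -failIfUnchanged (disch := omega) only [Operand.write, Operand.read, merge_apply_of_lt,
      merge_apply_of_le, Function.update_self, Function.update_of_ne, update_merge_of_lt,
      update_merge_of_le, Nat.add_zero, BinOp.eval_mod, BinOp.eval_eq, BinOp.eval_band,
      BinOp.eval_shr, BinOp.eval_div, BinOp.eval_lt, BinOp.eval_add_of_lt, BinOp.eval_sub_of_le,
      BinOp.eval_mul_of_lt, h17] at hv2 hR; subst hv2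
    simp only [execOps_nil] at hR; subst hR
    exact ⟨_, rfl, by simp, by simp⟩
  exact ⟨S', hex, h0, h1⟩

/-- The output read from the final memory is the one-word list `[flag]`. [folklore] -/
theorem readOut_final {S' : ℕ → ℕ} (h0 : S' 0 = 1) (h1 : S' 1 = flagW pv qv (n * n)) :
    readOut (merge S' H₁) = [flagW pv qv (n * n)] := by
  simp [readOut, readSeg, merge_apply_of_lt, h0, h1]

end loopC

end Literature.Computability.FineGrained.NegTriToMinPlus
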